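/-
Copyright (c) 2026 the pub-hodgecm-mathlib formalisation cell (harness21).  Prover seat hodgecm-mathlib-K2E5-p10 (g4), Track B «K2-LIT» ∕ h413
(`stmt-HodgeConjecture-24833`), line `K2_E3_EllipticInputs`, unit U12, §L road «U-iso-T» brick (G⁺-b)/(K3±): THE SIGNED (BOCHNER) CELL FORMULA for the
`K`-average of a bounded real (det, entry)-weight over `GL₂(𝒪)`.  2026-09-04.
-/
import Summits.HodgeConjecture.HodgeConjecture.Theorems.K2E3GL2TwistedWeightCells   -- ★ p857379 (this seat): `lintegral_glInt_detEntryWeight_eq_cells`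
import HarnessLib

/-!
# K2_E3 road (h413), §L brick (G⁺-b)/(K3±) — the signed cell formula

Cell `pub/hodgecm-mathlib` (D-0151), Track B, seat K2E5-p10 (g4) (E3 §L line; dealer K2E3-plan (g3); (G⁺-b): line side K2E5-p17 (g3), `K`-side this seat).
`--supports stmt-HodgeConjecture-24833 --as helper`; THEOREMS ONLY (no definition ∕ instance ∕ notation ∕ named fact ∕ `sorry`); never imports `Cruxes/…/Lines`.
COUNT-NEUTRAL.

The Bochner twin of ★ p857379: for a BOUNDED measurable real weight `Ω : F → F → ℝ` with `Ω(d·u, v·s) = Ω(d, s)` (`u, v ∈ 𝒪ˣ`, `uv ∈ (Fˣ)²`), `κ` Haar on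
`K = GL₂(𝒪)`, `dx` additive Haar and every `X ∈ 𝔤𝔩₂(F)`,
`∫_K Ω(det k, (k⁻¹Xk)₁₀) dκ = c · (∫_{σ ∈ 𝒪} Ω(1, P_X(σ)) dσ + ∫_{t ∈ 𝔭} Ω(−1, Q_X(t)) dt)` with the SAME constant `c` (now read in `ℝ`), by splitting `Ω` into its
positive and negative parts (**`integral_glInt_detEntryWeight_eq_cells`**).  This is the form in which the truncated twisted weights
`Ω_n(d,s) = χ̃(a⁻¹d)χ̃(s)‖s‖⁻¹1[s ∉ 𝔭^{2n}]` (real, bounded by `q^{2n}`) of the `K`-side enter.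
[HarishChandra1999AdmissibleDistributions, §7] [LabesseLanglands1979, §2]
HONEST LABEL: HC_CM is proved only modulo the 7 printed citations (2 remaining named inputs: hLiu418 = stmt-HodgeConjecture-24832, h413 =
stmt-HodgeConjecture-24833) until rung 0 closes; count-neutral helper toward (LBU-2⁺)∕(G⁺-b), NOT ★.

## References
* [HarishChandra1999AdmissibleDistributions] Harish-Chandra (DeBacker–Sally), *Admissible Invariant Distributions on Reductive p-adic Groups* (1999), §7.
* [LabesseLanglands1979] J.-P. Labesse, R. P. Langlands, *L-indistinguishability for SL(2)*, Canad. J. Math. 31 (1979), §2.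
-/

set_option autoImplicit false
set_option linter.dupNamespace false   -- `Summit.HodgeConjecture.HodgeConjecture.…` (D-0017 nested layout; lakefile exemption for Summits)

noncomputable section

open MeasureTheory Measure Filter Topology Set
open scoped MatrixGroups NNReal ENNReal Pointwise
open ValuativeRel
open Literature.NumberTheory.Automorphic Literature.NumberTheory.Automorphic.LocalFieldHaar
open Literature.NumberTheory.GaloisRepresentations Literature.NumberTheory.GaloisRepresentations.IsNonarchimedeanLocalField
open Summit.HodgeConjecture.HodgeConjecture.Cruxes.H413.K2E3GL2TwistedWeightCells

namespace Summit.HodgeConjecture.HodgeConjecture.Cruxes.H413.K2E3GL2TwistedWeightCellsSigned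

variable {F : Type*} [Field F] [ValuativeRel F] [TopologicalSpace F] [IsNonarchimedeanLocalField F]

section Signed
variable [MeasurableSpace F] [BorelSpace F] (dx : Measure F) [dx.IsAddHaarMeasure]
  [MeasurableSpace (GL (Fin 2) F)] [BorelSpace (GL (Fin 2) F)]

/-- A bounded measurable real function on a finite measure space: `∫ f = (∫⁻ f⁺).toReal − (∫⁻ f⁻).toReal`, both parts finite. [folklore] -/
theorem integral_eq_toReal_sub_toReal_of_bounded {α : Type*} [MeasurableSpace α] (μ : Measure α) [IsFiniteMeasure μ] {f : α → ℝ} (hf : Measurable f)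
    {M : ℝ} (hM : ∀ x, |f x| ≤ M) :
    ∫ x, f x ∂μ = (∫⁻ x, ENNReal.ofReal (f x) ∂μ).toReal - (∫⁻ x, ENNReal.ofReal (-f x) ∂μ).toReal ∧
      ∫⁻ x, ENNReal.ofReal (f x) ∂μ ≠ ⊤ ∧ ∫⁻ x, ENNReal.ofReal (-f x) ∂μ ≠ ⊤ := by
  have hint : Integrable f μ :=
    ⟨hf.aestronglyMeasurable, HasFiniteIntegral.of_bounded (C := M) (Eventually.of_forall fun x => by rw [Real.norm_eq_abs]; exact hM x)⟩
  refine ⟨integral_eq_lintegral_pos_part_sub_lintegral_neg_part hint, ?_, ?_⟩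
  · refine (lintegral_ofReal_le_lintegral_enorm f).trans_lt hint.2 |>.ne
  · refine (lintegral_ofReal_le_lintegral_enorm (fun x => -f x)).trans_lt hint.neg.2 |>.ne

/-- **THE SIGNED CELL FORMULA.**  For `κ` Haar on `K = GL₂(𝒪)` and `dx` additive Haar on `F` there is ONE real constant `c > 0` such that for every
measurable BOUNDED `Ω : F → F → ℝ` with `Ω (d·u) (v·s) = Ω d s` whenever `u, v ∈ 𝒪ˣ` with `u·v` a square, and every `X ∈ 𝔤𝔩₂(F)`:
`∫_K Ω(det k, (k⁻¹Xk)₁₀) dκ = c·(∫_{σ ∈ 𝒪} Ω(1, X₁₀ + σ(X₁₁ − X₀₀) − σ²X₀₁) dσ + ∫_{t ∈ 𝔭} Ω(−1, X₀₁ + t(X₀₀ − X₁₁) − t²X₁₀) dt)`.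
[cite: HarishChandra1999AdmissibleDistributions, §7] [cite: LabesseLanglands1979, §2] -/
theorem integral_glInt_detEntryWeight_eq_cells (κ : Measure ↥(glInt 2 F)) [κ.IsHaarMeasure] :
    ∃ c : ℝ, 0 < c ∧ ∀ Ω : F → F → ℝ, Measurable (Function.uncurry Ω) → ∀ M : ℝ, (∀ d s, |Ω d s| ≤ M) →
      (∀ (d s : F) (u v : Fˣ), normAbs F (u : F) = 1 → normAbs F (v : F) = 1 → IsSquare (u * v) → Ω (d * u) (v * s) = Ω d s) →
      ∀ X : Matrix (Fin 2) (Fin 2) F,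
        ∫ k, Ω (((k : GL (Fin 2) F) : Matrix (Fin 2) (Fin 2) F)).det
            ((((((k : GL (Fin 2) F))⁻¹ : GL (Fin 2) F) : Matrix (Fin 2) (Fin 2) F) * X * ((k : GL (Fin 2) F) : Matrix (Fin 2) (Fin 2) F)) 1 0) ∂κ =
          c * ((∫ σ in primePowBall F 0, Ω 1 (X 1 0 + σ * (X 1 1 - X 0 0) - σ ^ 2 * X 0 1) ∂dx) +
            ∫ t in primePowBall F 1, Ω (-1) (X 0 1 + t * (X 0 0 - X 1 1) - t ^ 2 * X 1 0) ∂dx) := by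
  haveI : T2Space F := (isLocalField F).toT2Space
  haveI : BorelSpace ↥(glInt 2 F) := Subtype.borelSpace _
  haveI : CompactSpace ↥(glInt 2 F) := isCompact_iff_compactSpace.1 (isCompact_glInt 2 F)
  haveI : IsFiniteMeasure κ := CompactSpace.isFiniteMeasure
  haveI h0fin : IsFiniteMeasure (dx.restrict (primePowBall F 0)) := isFiniteMeasure_restrict.2 (isCompact_primePowBall 0).measure_lt_top.ne
  haveI h1fin : IsFiniteMeasure (dx.restrict (primePowBall F 1)) := isFiniteMeasure_restrict.2 (isCompact_primePowBall 1).measure_lt_top.ne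
  obtain ⟨c, hc0, hct, hA⟩ := lintegral_glInt_detEntryWeight_eq_cells dx κ
  refine ⟨c.toReal, ENNReal.toReal_pos hc0 hct, fun Ω hΩm M hM hΩ X => ?_⟩
  -- measurability of the three composite integrands
  have hdet : Measurable fun k : ↥(glInt 2 F) => (((k : GL (Fin 2) F) : Matrix (Fin 2) (Fin 2) F)).det :=
    ((Continuous.matrix_det Units.continuous_val).comp continuous_subtype_val).measurable
  have hent : Measurable fun k : ↥(glInt 2 F) =>
      ((((((k : GL (Fin 2) F))⁻¹ : GL (Fin 2) F) : Matrix (Fin 2) (Fin 2) F) * X * ((k : GL (Fin 2) F) : Matrix (Fin 2) (Fin 2) F)) 1 0) :=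
    ((continuous_id.matrix_elem 1 0).comp (((Units.continuous_coe_inv.comp continuous_subtype_val).mul continuous_const).mul
      (Units.continuous_val.comp continuous_subtype_val))).measurable
  have hK : Measurable fun k : ↥(glInt 2 F) => Ω (((k : GL (Fin 2) F) : Matrix (Fin 2) (Fin 2) F)).det
      ((((((k : GL (Fin 2) F))⁻¹ : GL (Fin 2) F) : Matrix (Fin 2) (Fin 2) F) * X * ((k : GL (Fin 2) F) : Matrix (Fin 2) (Fin 2) F)) 1 0) :=
    hΩm.comp (hdet.prodMk hent)
  haveI : IsTopologicalRing F := inferInstance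
  have hPc : Continuous fun σ : F => X 1 0 + σ * (X 1 1 - X 0 0) - σ ^ 2 * X 0 1 :=
    (continuous_const.add (continuous_id.mul continuous_const)).sub ((continuous_id.pow 2).mul continuous_const)
  have hQc : Continuous fun t : F => X 0 1 + t * (X 0 0 - X 1 1) - t ^ 2 * X 1 0 :=
    (continuous_const.add (continuous_id.mul continuous_const)).sub ((continuous_id.pow 2).mul continuous_const)
  have hP : Measurable fun σ : F => Ω 1 (X 1 0 + σ * (X 1 1 - X 0 0) - σ ^ 2 * X 0 1) :=
    hΩm.comp (measurable_const.prodMk hPc.measurable)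
  have hQ : Measurable fun t : F => Ω (-1) (X 0 1 + t * (X 0 0 - X 1 1) - t ^ 2 * X 1 0) :=
    hΩm.comp (measurable_const.prodMk hQc.measurable)
  -- the positive and negative parts are invariant non-negative weights
  have hpos := hA (fun d s => ENNReal.ofReal (Ω d s)) hΩm.ennreal_ofReal
    (fun d s u v hu hv huv => by simp only [hΩ d s u v hu hv huv]) X
  have hneg := hA (fun d s => ENNReal.ofReal (-Ω d s)) hΩm.neg.ennreal_ofReal
    (fun d s u v hu hv huv => by simp only [hΩ d s u v hu hv huv]) X
  -- the three signed integrals as differences of finite lintegrals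
  obtain ⟨eK, fK1, fK2⟩ := integral_eq_toReal_sub_toReal_of_bounded κ hK (M := M) (fun k => hM _ _)
  obtain ⟨eP, fP1, fP2⟩ := integral_eq_toReal_sub_toReal_of_bounded (dx.restrict (primePowBall F 0)) hP (M := M) (fun σ => hM _ _)
  obtain ⟨eQ, fQ1, fQ2⟩ := integral_eq_toReal_sub_toReal_of_bounded (dx.restrict (primePowBall F 1)) hQ (M := M) (fun t => hM _ _)
  rw [eK, eP, eQ, hpos, hneg, ENNReal.toReal_mul, ENNReal.toReal_mul, ENNReal.toReal_add fP1 fQ1, ENNReal.toReal_add fP2 fQ2]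
  ring

end Signed

end Summit.HodgeConjecture.HodgeConjecture.Cruxes.H413.K2E3GL2TwistedWeightCellsSigned

end
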